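import Summits.ResolutionOfSingularities.ResolutionOfSingularities.Theorems.FrobeniusLadderFInjectiveMacaulayficationClosedPointLocalResolutionAdmTrMono
import Summits.ResolutionOfSingularities.ResolutionOfSingularities.Theorems.FrobeniusLadderFInjectiveMacaulayficationDimSliceOfCesnavicius
import HarnessLib

/-!
# THE PER-DIMENSION SLICES WITH THE RESOLUTION RUNGS AT ONE TRANSCENDENTAL (`r = 1`)
# (crux `FInjectiveMacaulayfication` stmt-ResolutionOfSingularities-15315, chain w45a, door v38; res-L1-w45a-plan-1 BOOKED 05:49:14Z (ii);
# seat res-L1-w45a-lead-1 g8, own object 2b)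

[OURS · L1 W4.5a] Support file (`--supports stmt-ResolutionOfSingularities-15315 --as helper`); replaces the role of NO printed item; NOT a
statement of any manuscript; def-free; AI-written (AI review is weaker than expert review).

res-L1-w45a-stub-3's slices of record (`DimSliceOfCesnavicius`, p604730) consume the transcendental-field rungs `ClosedPointLocalResolutionAdmTr p e r`
for ALL `r ≥ 1`; by transcendence monotonicity (`ClosedPointLocalResolutionAdmTrMono.closedPointLocalResolutionAdmTr_mono`, p607809) the rung at
`r = 1` implies every `r ≥ 1`. Hence:

* `fInjectiveMacaulayfication_dimLe_of_cesnaviciusOffClosed_of_trOne_of_F (d)` — on schemes of dimension `≤ d` the crux ⟸ {CP 2019 Thm 1.1, Stacks 081R,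
  CP 2019 Prop 4.4, Česnavičius 2021 Thm 5.3 (B)} ∧ **`ClosedPointLocalResolutionAdmTr p e 1` for `4 ≤ e ≤ d − 1`** ∧ the F-half at levels `4 … d`;
* ★ `fInjectiveMacaulayfication_dimLe5_of_cesnaviciusOffClosed_of_tr41_of_F45` — THE DIM-5 SENTENCE OF RECORD with ONE transcendental: on schemes of
  dimension `≤ 5` the crux ⟸ the four published theorems ∧ **`∀ p, p.Prime → ClosedPointLocalResolutionAdmTr p 4 1`** (closed-point admissible local
  uniformization of 4-folds over `k(s)`, `k` any field of characteristic `p`) ∧ F(4) ∧ F(5).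

(The EXACT-COUNT slice «per-`d` residue {T(p, e, d − e)}», weaker for `d ≥ 6`, needs the dimension formula and is res-L1-w45a-stub-3 g9's optional item 2.)
[cite: Cesnavicius2021, Thm. 5.3] [cite: CossartPiltant2019, Thm. 1.1; Prop. 4.4] [cite: Temkin2008, Prop. 2.3.4 (iii)]
-/

-- single-problem summit: the doubled namespace component is forced
set_option linter.dupNamespace false

noncomputable section

namespace Summit.ResolutionOfSingularities.ResolutionOfSingularities.Theorems.FInjectiveMacaulayfication.DimSliceTrOne

open CategoryTheory AlgebraicGeometry TopologicalSpace IsLocalRing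
open Literature.AlgebraicGeometry.Resolution
open Summit.ResolutionOfSingularities.ResolutionOfSingularities.Theorems.FInjectiveMacaulayfication
open SliceableCentre ClosedPointLocalResolutionAdmTr ClosedPointLocalResolutionAdmTrMono

/-- ★ **THE DIM ≤ d SLICE with the resolution rungs at `r = 1`**: on schemes of dimension `≤ d` the crux ⟸ {CP 1.1, 081R, CP 4.4, Česnavičius 5.3 (B)} ∧
`ClosedPointLocalResolutionAdmTr p e 1` for `4 ≤ e ≤ d − 1` ∧ the F-half at levels `4 … d`. From res-L1-w45a-stub-3's
`DimSliceOfCesnavicius.fInjectiveMacaulayfication_dimLe_of_cesnaviciusOffClosed_of_rungs_of_F` and transcendence monotonicity. [OURS · conditional-result]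
[cite: Cesnavicius2021, Thm. 5.3] [cite: CossartPiltant2019, Thm. 1.1; Prop. 4.4] [cite: Temkin2008, Prop. 2.3.4 (iii)] -/
theorem fInjectiveMacaulayfication_dimLe_of_cesnaviciusOffClosed_of_trOne_of_F (d : ℕ)
    (hG : CossartPiltant2019General.{0}) (h081R : Stacks081R.{0}) (hP : CossartPiltant2019Principalization.{0})
    (hM : CesnaviciusBlowupMacaulayficationOffClosed.{0})
    (hR1 : ∀ p e : ℕ, p.Prime → 4 ≤ e → e + 1 ≤ d → ClosedPointLocalResolutionAdmTr p e 1)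
    (hF : ∀ n : ℕ, 4 ≤ n → n ≤ d → ∀ (p : ℕ), p.Prime → ∀ (k : Type) [Field k] [CharP k p]
    (X : Scheme.{0}) (f : X ⟶ Spec (.of k)),
      IsSeparated f → LocallyOfFiniteType f → QuasiCompact f → IsIntegral X →
      ∀ x : X, IsClosed ({x} : Set X) → x ∉ Scheme.regularLocus X → ringKrullDim (X.presheaf.stalk x) = n →
      ∀ (S' : Scheme.{0}) (g : S' ⟶ Spec (X.presheaf.stalk x)) (I : (Spec (X.presheaf.stalk x)).IdealSheafData),
        I ≠ ⊥ → (I.support : Set (Spec (X.presheaf.stalk x))) ⊆ (Scheme.regularLocus (Spec (X.presheaf.stalk x)))ᶜ → IsBlowup g I →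
        (∀ s : S', g.base s ≠ closedPoint (X.presheaf.stalk x) → s ∈ Scheme.regularLocus S') →
        (∀ s : S', CMCl (S'.presheaf.stalk s)) →
        ∃ 𝓚 : S'.IdealSheafData, 𝓚 ≠ ⊥ ∧ (∀ s ∈ (𝓚.support : Set S'), g.base s = closedPoint (X.presheaf.stalk x)) ∧
          ∀ (S'' : Scheme.{0}) (π : S'' ⟶ S'), IsBlowup π 𝓚 →
            ∀ s : S'', FullCl p (S''.presheaf.stalk s)) :
    ∀ p : ℕ, p.Prime → ∀ (k : Type) [Field k] [CharP k p] (X : Scheme.{0}) (f : X ⟶ Spec (.of k)),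
      IsSeparated f → LocallyOfFiniteType f → QuasiCompact f → IsReduced X → topologicalKrullDim X ≤ d →
      ∃ (X' : Scheme.{0}) (π : X' ⟶ X), IsProper π ∧ IsBirational π ∧ ∀ x : X',
        IsDomain (X'.presheaf.stalk x) ∧ ∀ d : ℕ, ringKrullDim (X'.presheaf.stalk x) = d →
          ∀ s : Fin d → X'.presheaf.stalk x, (Ideal.span (Set.range s)).radical.IsMaximal →
            RingTheory.Sequence.IsWeaklyRegular (X'.presheaf.stalk x) (List.ofFn s) ∧
            ∀ y : X'.presheaf.stalk x, (∃ e : ℕ, y ^ p ^ e ∈ Ideal.span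
              ((fun z : X'.presheaf.stalk x => z ^ p ^ e) ''
                (Ideal.span (Set.range s) : Set (X'.presheaf.stalk x)))) →
              y ∈ Ideal.span (Set.range s) :=
  DimSliceOfCesnavicius.fInjectiveMacaulayfication_dimLe_of_cesnaviciusOffClosed_of_rungs_of_F d hG h081R hP hM
    (fun p e r hp he hed hr => forall_tr_iff_tr_one.mpr (hR1 p e hp he hed) r hr) hF

/-- ★★ **THE DIM-5 SENTENCE OF RECORD, ONE TRANSCENDENTAL**: on schemes of dimension `≤ 5` the crux ⟸ {CP 1.1, 081R, CP 4.4, Česnavičius 5.3 (B)} ∧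
**`∀ p, p.Prime → ClosedPointLocalResolutionAdmTr p 4 1`** — closed-point admissible local uniformization of 4-folds over `k(s)` (ONE transcendental),
`k` any field of characteristic `p` — ∧ F(4) ∧ F(5). From `DimSliceOfCesnavicius.…_dimLe5_of_cesnaviciusOffClosed_of_tr4_of_F45` (res-L1-w45a-stub-3)
and `forall_tr_iff_tr_one`. [OURS · conditional-result] [cite: Cesnavicius2021, Thm. 5.3] [cite: CossartPiltant2019, Thm. 1.1; Prop. 4.4]
[cite: Temkin2008, Prop. 2.3.4 (iii)] -/
theorem fInjectiveMacaulayfication_dimLe5_of_cesnaviciusOffClosed_of_tr41_of_F45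
    (hG : CossartPiltant2019General.{0}) (h081R : Stacks081R.{0}) (hP : CossartPiltant2019Principalization.{0})
    (hM : CesnaviciusBlowupMacaulayficationOffClosed.{0})
    (hR41 : ∀ p : ℕ, p.Prime → ClosedPointLocalResolutionAdmTr p 4 1)
    (hF4 : ∀ (p : ℕ), p.Prime → ∀ (k : Type) [Field k] [CharP k p]
    (X : Scheme.{0}) (f : X ⟶ Spec (.of k)),
      IsSeparated f → LocallyOfFiniteType f → QuasiCompact f → IsIntegral X →
      ∀ x : X, IsClosed ({x} : Set X) → x ∉ Scheme.regularLocus X → ringKrullDim (X.presheaf.stalk x) = 4 →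
      ∀ (S' : Scheme.{0}) (g : S' ⟶ Spec (X.presheaf.stalk x)) (I : (Spec (X.presheaf.stalk x)).IdealSheafData),
        I ≠ ⊥ → (I.support : Set (Spec (X.presheaf.stalk x))) ⊆ (Scheme.regularLocus (Spec (X.presheaf.stalk x)))ᶜ → IsBlowup g I →
        (∀ s : S', g.base s ≠ closedPoint (X.presheaf.stalk x) → s ∈ Scheme.regularLocus S') →
        (∀ s : S', CMCl (S'.presheaf.stalk s)) →
        ∃ 𝓚 : S'.IdealSheafData, 𝓚 ≠ ⊥ ∧ (∀ s ∈ (𝓚.support : Set S'), g.base s = closedPoint (X.presheaf.stalk x)) ∧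
          ∀ (S'' : Scheme.{0}) (π : S'' ⟶ S'), IsBlowup π 𝓚 →
            ∀ s : S'', FullCl p (S''.presheaf.stalk s))
    (hF5 : ∀ (p : ℕ), p.Prime → ∀ (k : Type) [Field k] [CharP k p]
    (X : Scheme.{0}) (f : X ⟶ Spec (.of k)),
      IsSeparated f → LocallyOfFiniteType f → QuasiCompact f → IsIntegral X →
      ∀ x : X, IsClosed ({x} : Set X) → x ∉ Scheme.regularLocus X → ringKrullDim (X.presheaf.stalk x) = 5 →
      ∀ (S' : Scheme.{0}) (g : S' ⟶ Spec (X.presheaf.stalk x)) (I : (Spec (X.presheaf.stalk x)).IdealSheafData),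
        I ≠ ⊥ → (I.support : Set (Spec (X.presheaf.stalk x))) ⊆ (Scheme.regularLocus (Spec (X.presheaf.stalk x)))ᶜ → IsBlowup g I →
        (∀ s : S', g.base s ≠ closedPoint (X.presheaf.stalk x) → s ∈ Scheme.regularLocus S') →
        (∀ s : S', CMCl (S'.presheaf.stalk s)) →
        ∃ 𝓚 : S'.IdealSheafData, 𝓚 ≠ ⊥ ∧ (∀ s ∈ (𝓚.support : Set S'), g.base s = closedPoint (X.presheaf.stalk x)) ∧
          ∀ (S'' : Scheme.{0}) (π : S'' ⟶ S'), IsBlowup π 𝓚 →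
            ∀ s : S'', FullCl p (S''.presheaf.stalk s)) :
    ∀ p : ℕ, p.Prime → ∀ (k : Type) [Field k] [CharP k p] (X : Scheme.{0}) (f : X ⟶ Spec (.of k)),
      IsSeparated f → LocallyOfFiniteType f → QuasiCompact f → IsReduced X → topologicalKrullDim X ≤ 5 →
      ∃ (X' : Scheme.{0}) (π : X' ⟶ X), IsProper π ∧ IsBirational π ∧ ∀ x : X',
        IsDomain (X'.presheaf.stalk x) ∧ ∀ d : ℕ, ringKrullDim (X'.presheaf.stalk x) = d →
          ∀ s : Fin d → X'.presheaf.stalk x, (Ideal.span (Set.range s)).radical.IsMaximal →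
            RingTheory.Sequence.IsWeaklyRegular (X'.presheaf.stalk x) (List.ofFn s) ∧
            ∀ y : X'.presheaf.stalk x, (∃ e : ℕ, y ^ p ^ e ∈ Ideal.span
              ((fun z : X'.presheaf.stalk x => z ^ p ^ e) ''
                (Ideal.span (Set.range s) : Set (X'.presheaf.stalk x)))) →
              y ∈ Ideal.span (Set.range s) :=
  DimSliceOfCesnavicius.fInjectiveMacaulayfication_dimLe5_of_cesnaviciusOffClosed_of_tr4_of_F45 hG h081R hP hM
    (fun p r hp hr => forall_tr_iff_tr_one.mpr (hR41 p hp) r hr) hF4 hF5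

end Summit.ResolutionOfSingularities.ResolutionOfSingularities.Theorems.FInjectiveMacaulayfication.DimSliceTrOne

end
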